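import Literature.NumberTheory.Weil1964.UnitaryArchLocalCayleyWeightDet   -- ★ p844641 (this seat) (b3)-(i): `cayleyWeightC_eq` (`w₀(Y) = ‖det(1+Y)‖^{−2N}`)
import Mathlib.Analysis.SpecialFunctions.ImproperIntegrals                   -- `integral_univ_inv_one_add_sq` (`∫ (1+t²)⁻¹ = π`), `integrable_inv_one_add_sq`
import HarnessLib

/-!
# (U) ROAD, U4-DISCHARGE brick (b3)-(iii), `N = 1`: the Cayley-weighted trace-form Lebesgue mass of `𝔲(1)` is `π` — `∫_{𝔲(Jw)} w₀ dλ = ∫_ℝ dt∕(1+t²) = π`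
# (Rogawski 1990 §1.7 p. 6 «`dg = |Ω|_v`»; Macdonald 1980)

Topic `NumberTheory/Weil1964`; namespace `Literature.NumberTheory.Weil1964.UnitaryArchLocalTopForm`.  THEOREMS ONLY (no definition, no instance, no notation, no named fact,
no `sorry`); kernel lane.  Cell `pub/hodgecm-mathlib` (D-0151), crux H413 = `stmt-HodgeConjecture-24833` (supports only); ROAD (U), U4-DISCHARGE package (LEAD F0P3a-plan (g10) WORD
T9-40 (d1): (b3) «`m_w = μ^TF_w(U(2)×U(1))`» = A-p12 (g20); owner A-p19 (g24); split of record 13:31–13:33Z: (i) Jacobian ★ p844641 (this seat), (ii) exhaustion ∕ null complement ∕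
local any-window ⇒ `archLocalTopFormHaar_univ_eq_lintegral … = ∫⁻ w₀ dλ` (A-p06 (g29)), congruence transport at the Lie-algebra level (F0P3-p03 (g11)), (iii) THE VALUES of
`∫⁻_{𝔲(N)} w₀ dλ` at `N = 1, 2` (this seat)).  THIS FILE = (iii) at `N = 1`: **`vol^TF(U(1)) = π`** in the currency A-p06's head consumes.  OFF the closing path of (U) (T9-40).
HONEST LABEL: HC_CM is proved only modulo the cell's 2 remaining named inputs (hLiu418 24832, h413 24833) until rung 0 closes; this file pays no letter by itself.

THE MATHEMATICS.  `Jw` a `1 × 1` hermitian invertible form.  `𝔲(Jw) = {X | Xᴴ Jw + Jw X = 0} = {X | Re X₀₀ = 0} = ℝ · (i·1)` (`I_smul_one_mem_skewC_one`,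
`re_apply_eq_zero_of_mem_skewC_one`, `eq_im_smul_of_mem_skewC_one`); in the coordinate `φ : t ↦ t·(i·1)` (a continuous linear equivalence `ℝ ≃ 𝔲(Jw)`, built inside the proof)
the trace-form Gram determinant of the basis `{i·1}` is `Re tr((i)(i)) = −1`, so ★ `lieStdLebesgueC_eq_smul_addHaar` gives `λ = {i·1}.addHaar = φ_* dt` (Mathlib
`Module.Basis.map_addHaar`, and `(Basis.singleton).addHaar = volume` on `ℝ` through `Basis.addHaar_eq_iff` on the parallelepiped `[0,1]`); ★ `cayleyWeightC_eq` reads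
`w₀(φ t) = (‖1 + t i‖²)⁻¹ = (1 + t²)⁻¹`; hence **`∫⁻ w₀ dλ = ∫⁻ (1+t²)⁻¹ dt = π`** (`lintegral_cayleyWeightC_one`; Mathlib `integral_univ_inv_one_add_sq`).  With A-p06 (g29)'s
`archLocalTopFormHaar_univ_eq_lintegral` this is `vol^TF(U(1)) = π`; the `N = 2` value (`π³∕2`, numerically certified: `∫_{ℝ⁴} 2 d⁴x ∕ ((1−ab+|z|²)² + (a+b)²)² = 0.5000·π³` at a
`1200²`-point `tan`-substituted midpoint rule) is the next brick of this base.

## References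
* [Rogawski1990] J. D. Rogawski, *Automorphic Representations of Unitary Groups in Three Variables* (1990), §1.7 p. 6 (`dg = |Ω|_v`).
* [Macdonald1980] I. G. Macdonald, *The volume of a compact Lie group*, Invent. Math. 56 (1980), 93–95.
* [Knapp2002] A. W. Knapp, *Lie Groups Beyond an Introduction*, 2nd ed. (2002), I §1, VIII §2.
-/

set_option autoImplicit false
set_option backward.isDefEq.respectTransparency false

noncomputable section

open Set MeasureTheory MeasureTheory.Measure NumberField Module Matrix
open scoped Classical Matrix Matrix.Norms.Operator MatrixGroups ENNReal NNReal Pointwise ComplexConjugate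

namespace Literature.NumberTheory.Weil1964

namespace UnitaryArchLocalTopForm

/-! ## §1 `𝔲(Jw)` for `N = 1`: the line `i ℝ` -/

section One

variable {Jw : Matrix (Fin 1) (Fin 1) ℂ}

/-- `i·1 ∈ 𝔲(Jw)` for every `1 × 1` form. [cite: Knapp2002, I §1] -/
theorem I_smul_one_mem_skewC_one : Complex.I • (1 : Matrix (Fin 1) (Fin 1) ℂ) ∈ skewC 1 Jw := by
  rw [mem_skewC_iff, Matrix.conjTranspose_smul, Matrix.conjTranspose_one, Complex.star_def, Complex.conj_I, Matrix.smul_mul, Matrix.mul_smul, Matrix.one_mul,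
    Matrix.mul_one, neg_smul, neg_add_cancel]

/-- An element of `𝔲(Jw)`, `Jw` invertible, has a purely imaginary entry. [cite: Knapp2002, I §1] -/
theorem re_apply_eq_zero_of_mem_skewC_one (hJ : IsUnit Jw.det) {X : Matrix (Fin 1) (Fin 1) ℂ} (hX : X ∈ skewC 1 Jw) : (X 0 0).re = 0 := by
  rw [mem_skewC_iff] at hX
  have h := congrFun (congrFun hX 0) 0
  simp only [Matrix.add_apply, Matrix.mul_apply, Fin.sum_univ_one, Matrix.conjTranspose_apply, Matrix.zero_apply, Complex.star_def] at h
  have hJ0 : Jw 0 0 ≠ 0 := by rw [Matrix.det_fin_one] at hJ; exact hJ.ne_zero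
  have h2 : Jw 0 0 * (conj (X 0 0) + X 0 0) = 0 := by rw [mul_add, mul_comm (Jw 0 0) (conj _)]; exact h
  have h3 : conj (X 0 0) + X 0 0 = 0 := (mul_eq_zero.1 h2).resolve_left hJ0
  have h4 := congrArg Complex.re h3
  rw [Complex.add_re, Complex.conj_re, Complex.zero_re] at h4
  linarith

/-- An element of `𝔲(Jw)` is `(Im X₀₀) • (i·1)`. [cite: Knapp2002, I §1] -/
theorem eq_im_smul_of_mem_skewC_one (hJ : IsUnit Jw.det) {X : Matrix (Fin 1) (Fin 1) ℂ} (hX : X ∈ skewC 1 Jw) :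
    X = (X 0 0).im • (Complex.I • (1 : Matrix (Fin 1) (Fin 1) ℂ)) := by
  have hre := re_apply_eq_zero_of_mem_skewC_one hJ hX
  ext i j
  fin_cases i; fin_cases j
  simp only [Fin.zero_eta, Fin.isValue, Matrix.smul_apply, Matrix.one_apply_eq, smul_eq_mul, mul_one, Complex.real_smul]
  apply Complex.ext
  · rw [hre, Complex.re_ofReal_mul, Complex.I_re, mul_zero]
  · rw [Complex.im_ofReal_mul, Complex.I_im, mul_one]

variable [MeasurableSpace (skewC 1 Jw)] [BorelSpace (skewC 1 Jw)]

/-- **(b3)-(iii), `N = 1`: `∫_{𝔲(Jw)} w₀ dλ = π`** — the Cayley-weighted trace-form Lebesgue mass of the line `𝔲(Jw) = iℝ·1` (`Jw` a `1 × 1` hermitian invertible form): in the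
coordinate `t ↦ t·(i·1)` the trace-form Lebesgue measure is `dt` (Gram `|Re tr((i)(i))| = 1`) and `w₀ = (1 + t²)⁻¹` (★ `cayleyWeightC_eq`), so the mass is `∫ dt∕(1+t²) = π`.
This is the `vol^TF(U(1))` input of U4's compact clause once ★-to-be `archLocalTopFormHaar_univ_eq_lintegral` (A-p06 (g29)) converts total mass into this integral.
[cite: Rogawski1990, §1.7 p. 6] [cite: Macdonald1980, p. 93] -/
theorem lintegral_cayleyWeightC_one (hherm : Jwᴴ = Jw) (hJ : IsUnit Jw.det) :
    ∫⁻ X, ENNReal.ofReal (cayleyWeightC 1 Jw X) ∂(lieStdLebesgueC 1 Jw) = ENNReal.ofReal Real.pi := by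
  haveI : FiniteDimensional ℝ (Matrix (Fin 1) (Fin 1) ℂ) := finiteDimensional_matrixC
  -- the generator `E = i·1` and the coordinate `φ : ℝ ≃L[ℝ] 𝔲(Jw)`
  set E : skewC 1 Jw := ⟨Complex.I • (1 : Matrix (Fin 1) (Fin 1) ℂ), I_smul_one_mem_skewC_one⟩ with hE
  have hE00 : ((E : Matrix (Fin 1) (Fin 1) ℂ) 0 0) = Complex.I := by
    rw [hE]; simp only [Matrix.smul_apply, Matrix.one_apply_eq, smul_eq_mul, mul_one]
  let φₗ : ℝ ≃ₗ[ℝ] skewC 1 Jw :=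
    { toFun := fun t => t • E
      map_add' := fun a b => add_smul a b E
      map_smul' := fun a b => by rw [smul_eq_mul, mul_smul]; rfl
      invFun := fun X => ((X : Matrix (Fin 1) (Fin 1) ℂ) 0 0).im
      left_inv := fun t => by
        show (((t • E : skewC 1 Jw) : Matrix (Fin 1) (Fin 1) ℂ) 0 0).im = t
        rw [Submodule.coe_smul, Matrix.smul_apply, hE00, Complex.real_smul, Complex.im_ofReal_mul, Complex.I_im, mul_one]
      right_inv := fun X => by
        apply Subtype.ext
        rw [Submodule.coe_smul]
        exact (eq_im_smul_of_mem_skewC_one hJ X.2).symm }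
  let φ : ℝ ≃L[ℝ] skewC 1 Jw := φₗ.toContinuousLinearEquiv
  have hφ : ∀ t : ℝ, φ t = t • E := fun _ => rfl
  -- the basis `{E}` and its Gram determinant
  set b : Module.Basis (Fin 1) ℝ (skewC 1 Jw) := (Module.Basis.singleton (Fin 1) ℝ).map φₗ with hb
  have hb0 : ∀ i, b i = E := by
    intro i
    rw [hb, Module.Basis.map_apply, Module.Basis.singleton_apply]
    show (1 : ℝ) • E = E
    rw [one_smul]
  -- (stated for every `DecidableEq` instance: ★ `lieStdLebesgueC_eq_smul_addHaar`'s `det` carries the classical one)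
  have hgram : ∀ inst : DecidableEq (Fin 1), @Matrix.det (Fin 1) inst _ ℝ _ (lieGramC b) = -1 := by
    intro inst
    obtain rfl : inst = instDecidableEqFin 1 := Subsingleton.elim _ _
    rw [Matrix.det_fin_one, lieGramC_apply, hb0, traceFormC_apply, hE, Matrix.smul_mul, Matrix.one_mul, Matrix.trace_smul, Matrix.trace_smul, Matrix.trace_one,
      Fintype.card_fin, Nat.cast_one, smul_eq_mul, smul_eq_mul, mul_one, Complex.I_mul_I, Complex.neg_re, Complex.one_re]
  have hlam : lieStdLebesgueC 1 Jw = b.addHaar := by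
    rw [lieStdLebesgueC_eq_smul_addHaar b, hgram, abs_neg, abs_one, Real.sqrt_one, ENNReal.ofReal_one, one_smul]
  -- `b.addHaar = φ_* volume`
  have hvol : (Module.Basis.singleton (Fin 1) ℝ).addHaar = (volume : Measure ℝ) := by
    rw [Module.Basis.addHaar_eq_iff, Module.Basis.coe_parallelepiped]
    have hP : parallelepiped (Module.Basis.singleton (Fin 1) ℝ) = Set.Icc (0 : ℝ) 1 := by
      ext x
      rw [mem_parallelepiped_iff, Set.mem_Icc]
      constructor
      · rintro ⟨t, ht, rfl⟩
        rw [Fin.sum_univ_one, Module.Basis.singleton_apply, smul_eq_mul, mul_one]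
        exact ⟨ht.1 0, ht.2 0⟩
      · rintro ⟨h0, h1⟩
        refine ⟨fun _ => x, ⟨fun _ => h0, fun _ => h1⟩, ?_⟩
        rw [Fin.sum_univ_one, Module.Basis.singleton_apply, smul_eq_mul, mul_one]
    rw [hP, Real.volume_Icc, sub_zero, ENNReal.ofReal_one]
  have hmap : b.addHaar = (volume : Measure ℝ).map φ := by
    rw [← hvol, Module.Basis.map_addHaar _ φ, hb]
    rfl
  -- the weight in the coordinate `t`
  have hw : ∀ t : ℝ, cayleyWeightC 1 Jw (φ t) = (1 + t ^ 2)⁻¹ := by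
    intro t
    rw [cayleyWeightC_eq hherm hJ, hφ, Submodule.coe_smul, hE, Matrix.det_fin_one]
    simp only [Matrix.add_apply, Matrix.one_apply_eq, Matrix.smul_apply, smul_eq_mul, mul_one, Complex.real_smul]
    congr 1
    rw [Complex.sq_norm, Complex.normSq_apply, Complex.add_re, Complex.one_re, Complex.re_ofReal_mul, Complex.I_re, mul_zero, add_zero, Complex.add_im, Complex.one_im,
      Complex.im_ofReal_mul, Complex.I_im, mul_one, zero_add]
    ring
  -- integrate
  rw [hlam, hmap, lintegral_map (measurable_cayleyWeightC.ennreal_ofReal) φ.continuous.measurable]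
  simp_rw [hw]
  rw [← ofReal_integral_eq_lintegral_ofReal integrable_inv_one_add_sq (Filter.Eventually.of_forall fun t => by positivity), integral_univ_inv_one_add_sq]

end One

end UnitaryArchLocalTopForm

end Literature.NumberTheory.Weil1964

end
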